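import Summits.BirchSwinnertonDyer.BirchSwinnertonDyer.Theses.GenusKolyvaginAtTwo
import Summits.BirchSwinnertonDyer.BirchSwinnertonDyer.Theorems.GenusKolyvaginAtTwoShaCardDvdPowAtTwoRTRankQ
import HarnessLib

/-!
# Route `GenusKolyvaginAtTwo`, supply crux `GenusDeepSupplyAtTwoNegDisc` (stmt-BirchSwinnertonDyer-23467, rev 39) —
# A NECESSARY CONDITION: the crux as typed forces `#Sel₂(E/ℚ) ∣ 4` (and `#Ш(E/ℚ)[2] ∣ 4`) for EVERY habitat curve with `Δ < 0`

Seat `bsd-line-gk2-p2` g21 (PROVER seat 2/3, cell `bsd-f1-sign2`), `--supports stmt-BirchSwinnertonDyer-23467` (helper; closes nothing,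
refutes nothing).  THEOREMS ONLY (no definition, no named fact, no `sorry`); standard axioms.  BSD is NOT proved by any of this.

WHAT.  Rev 39 (R7-d; LINE 19 `rational_pair_descent` of LEAD gk2-p1 g19) appended to the supply crux's OUTPUT the TAMAGAWA-SHALLOW clause
`padicValNat 2 Wd.tamagawaProduct ≤ 1` of the `2`-Selmer-minimal twin `Wd ≅ E^(d_K)` (`#Sel₂(Wd) = 2`).  By gk2-p3 g26's UNCONDITIONAL (RANKQ)
`natCard_selmerGroup_two_dvd_four_of_genusBudget_le_one_unramified` (Mazur–Rubin Cor. 3.4 (i) for the Heegner twin at a single transposition prime,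
the other primes of `d_K` silent, `2` split or inert), the EXISTENCE of such a pair `(K, Wd)` for a given `E` (globally minimal, `Δ_E < 0`, `C(E)` odd;
`K` imaginary quadratic with odd `d_K`, Heegner) already forces `#Sel₂(E/ℚ) ∣ 4`, hence `#Ш(E/ℚ)[2] ∣ 4`.  So:

* `natCard_selmerGroup_two_dvd_four_of_genusDeepSupplyAtTwoNegDisc` — **`GenusDeepSupplyAtTwoNegDisc` ⟹ for every `E` in the crux's own
  habitat (non-CM, `r_an = 0`, `ρ_{E,2^n}` onto for all `n ≥ 1`, odd Tamagawa product, `Δ < 0`, an optimal parametrisation with odd Manin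
  constant): `#Sel₂(E/ℚ) ∣ 4`;**
* `natCard_sha_torsionBy_two_dvd_four_of_genusDeepSupplyAtTwoNegDisc` — same ⟹ `#Ш(E/ℚ)[2] ∣ 4`;
* `not_genusDeepSupplyAtTwoNegDisc_of_wideSelmer` — contrapositive: ONE habitat curve with `Δ < 0` and `¬ #Sel₂(E/ℚ) ∣ 4` (i.e. `Ш(E/ℚ)[2] ⊇ (ℤ/2)⁴`,
  as `E(ℚ)` is finite and `2`-torsion-free there) makes the crux FALSE as typed.

WHY IT MATTERS (planner-facing).  The crux quantifies over ALL conductors; the pen's census («438/438 W52 NegDisc cells have such a field»,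
SQUEEZE-CENSUS-g21 §6) certifies the live configuration only on the census.  Any rank-`0` habitat curve with `Δ < 0` and `Ш(E/ℚ)[2^∞] ⊇ (ℤ/2)⁴`
(Delaunay-generic at `#Ш_an ≥ 16`) refutes 23467 — not in the kernel (its antecedents `W.analyticRank = 0` and the odd-Manin parametrisation
datum are not certifiable for a named curve in the tree), but by evidence.  The cheap repair is to add `Nat.card (W.selmerGroup 2) ∣ 4` (equivalently
`#Ш(E/ℚ)[2] ∣ 4`) to the habitat of 23467 — it costs `closes` only a new declared residual slice (the `(ℤ/2)⁴`-cells, where LINE 19's U_T cut is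
empty anyway by the same (RANKQ)) and loses no census cell.  This file is the kernel half of that remark; the curve search is a -data / cdisprove job.

References: [MazurRubin2010] Cor. 3.4 (i), Prop. 3.3; [Kramer1981] §2 Prop. 3, Thm. 1; [SilvermanAEC2009] Thm. X.4.2.
-/

set_option linter.dupNamespace false -- tree convention: `Summit.BirchSwinnertonDyer.BirchSwinnertonDyer.Theorems` (summit = sub-problem)
set_option autoImplicit false

noncomputable section

open scoped Classical

namespace Summit.BirchSwinnertonDyer.BirchSwinnertonDyer.Theorems.GenusExact.PlusDescent

open WeierstrassCurve NumberField Literature.NumberTheory.EllipticCurves Literature.NumberTheory.EllipticCurves.ModularForms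
open Summit.BirchSwinnertonDyer.BirchSwinnertonDyer.Theses.GenusKolyvaginAtTwo (GenusDeepSupplyAtTwoNegDisc)

/-- **The supply crux forces `#Sel₂(E/ℚ) ∣ 4` on its whole habitat.**  If `GenusDeepSupplyAtTwoNegDisc` (stmt-23467, rev 39) holds, then every
globally minimal non-CM `E/ℚ` with `r_an(E) = 0`, `ρ_{E,2^n}` onto for all `n ≥ 1`, odd Tamagawa product, `Δ_E < 0` and an optimal parametrisation
with odd Manin constant has `#Sel₂(E/ℚ) ∣ 4`: the crux hands an imaginary quadratic `K` with odd `d_K`, Heegner for `N_E`, and a twin `Wd ≅ E^(d_K)`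
with `#Sel₂(Wd) = 2` and `ord₂ C(Wd) ≤ 1`, and (RANKQ) `natCard_selmerGroup_two_dvd_four_of_genusBudget_le_one_unramified` (gk2-p3 g26;
Mazur–Rubin Cor. 3.4 (i) at the transposition prime of `d_K`) gives the divisibility.  [cite: MazurRubin2010, Cor. 3.4 (i)] [cite: Kramer1981, §2 Thm. 1] -/
theorem natCard_selmerGroup_two_dvd_four_of_genusDeepSupplyAtTwoNegDisc (h : GenusDeepSupplyAtTwoNegDisc)
    (W : WeierstrassCurve ℚ) [W.IsElliptic] [W.IsGloballyMinimal] [NeZero (W.conductorNorm ℤ)]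
    (hcm : ¬ W.HasCM) (hr0 : W.analyticRank = 0) (hρ : ∀ n : ℕ, 0 < n → W.HasSurjectiveModNGaloisRep ((2 : ℤ) ^ n))
    (hT : Odd W.tamagawaProduct) (hΔ : W.Δ < 0)
    (hopt : ∃ Dt : ModularParametrizationData W (W.conductorNorm ℤ),
      (∀ z ∈ Dt.L.lattice, ∃ w ∈ periodLattice Dt.f, z = (Dt.c : ℂ) * w) ∧ Odd Dt.c) :
    Nat.card (W.selmerGroup 2) ∣ 4 := by
  obtain ⟨K, _, _, hIQ, hodd, _, hHe, _, _, _Dt, _β, _ι, _d₁, _, _, _, _M₀, _, _, _n, _d, _, _, _, Wd, _, _, hWd, _, _, hSel, hle⟩ :=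
    h W hcm hr0 hρ hT hΔ hopt
  exact natCard_selmerGroup_two_dvd_four_of_genusBudget_le_one_unramified W hΔ hT hIQ hodd hHe Wd hWd hle hSel

/-- **… hence `#Ш(E/ℚ)[2] ∣ 4` on the whole habitat** (`#Ш[2] ∣ #Sel₂`, gk2-p3's `natCard_sha_torsionBy_dvd_natCard_selmerGroup`).
[cite: MazurRubin2010, Cor. 3.4 (i)] [cite: SilvermanAEC2009, Thm. X.4.2] -/
theorem natCard_sha_torsionBy_two_dvd_four_of_genusDeepSupplyAtTwoNegDisc (h : GenusDeepSupplyAtTwoNegDisc)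
    (W : WeierstrassCurve ℚ) [W.IsElliptic] [W.IsGloballyMinimal] [NeZero (W.conductorNorm ℤ)]
    (hcm : ¬ W.HasCM) (hr0 : W.analyticRank = 0) (hρ : ∀ n : ℕ, 0 < n → W.HasSurjectiveModNGaloisRep ((2 : ℤ) ^ n))
    (hT : Odd W.tamagawaProduct) (hΔ : W.Δ < 0)
    (hopt : ∃ Dt : ModularParametrizationData W (W.conductorNorm ℤ),
      (∀ z ∈ Dt.L.lattice, ∃ w ∈ periodLattice Dt.f, z = (Dt.c : ℂ) * w) ∧ Odd Dt.c) :
    Nat.card (AddSubgroup.torsionBy W.sha (2 : ℤ)) ∣ 4 := by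
  have hsha := natCard_sha_torsionBy_dvd_natCard_selmerGroup W (n := 2) two_ne_zero
  simp only [Nat.cast_ofNat] at hsha
  exact hsha.trans (natCard_selmerGroup_two_dvd_four_of_genusDeepSupplyAtTwoNegDisc h W hcm hr0 hρ hT hΔ hopt)

/-- **Contrapositive (refutation shape, by evidence only).**  A single curve in the crux's habitat (`Δ < 0` branch) whose `2`-Selmer group has
order NOT dividing `4` — e.g. a rank-`0` habitat curve with `Ш(E/ℚ)[2] ≅ (ℤ/2)⁴` — falsifies `GenusDeepSupplyAtTwoNegDisc` as typed at rev 39.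
(The antecedents `W.analyticRank = 0` and the odd-Manin datum are not kernel-certifiable for a named curve, so this is the socket for an
evidence-level witness, not a kernel refutation.) [cite: MazurRubin2010, Cor. 3.4 (i)] -/
theorem not_genusDeepSupplyAtTwoNegDisc_of_wideSelmer
    (W : WeierstrassCurve ℚ) [W.IsElliptic] [W.IsGloballyMinimal] [NeZero (W.conductorNorm ℤ)]
    (hcm : ¬ W.HasCM) (hr0 : W.analyticRank = 0) (hρ : ∀ n : ℕ, 0 < n → W.HasSurjectiveModNGaloisRep ((2 : ℤ) ^ n))
    (hT : Odd W.tamagawaProduct) (hΔ : W.Δ < 0)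
    (hopt : ∃ Dt : ModularParametrizationData W (W.conductorNorm ℤ),
      (∀ z ∈ Dt.L.lattice, ∃ w ∈ periodLattice Dt.f, z = (Dt.c : ℂ) * w) ∧ Odd Dt.c)
    (hwide : ¬ Nat.card (W.selmerGroup 2) ∣ 4) : ¬ GenusDeepSupplyAtTwoNegDisc :=
  fun h ↦ hwide (natCard_selmerGroup_two_dvd_four_of_genusDeepSupplyAtTwoNegDisc h W hcm hr0 hρ hT hΔ hopt)

end Summit.BirchSwinnertonDyer.BirchSwinnertonDyer.Theorems.GenusExact.PlusDescent

end
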